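/-
Origin: expansion seat `planner-pub-hodgecm-mc-theta-3-g13-0`, handover (TT) 2026-08-20T07:55:05Z md5 abaff99f28225608410b1293656d35b7 (507 l.; NEW additive leaf over (BT) `ArchSlotBoxTorus` + RUN-43 (SL) `ArchSlotTypeLetters` + RUN-42 (LS) `ArchLineSlotDatum` + binder-2's `HypCensus/SmoothBlockSlotNeg`, `HypCensus/LetterIns`; rowdep (BT) → (TT); (J-μ) Step 2 = (R-χ): HEADLINE pinTorusType₁ − pinTorusType₀ = slotDelta S (closed V-free table), slotTypeVec 1 − slotTypeVec 0 = slotDelta c.D; cert rc 0/33 s/0 warn/0 proof holes; axioms 35/35 ⊆ trio) (`HOME/mc/pub-hodgecm-mc-theta-3-g13/lean/stage44/HodgeCM/Model/ArchSlotBoxTorusType.lean`, md5 abaff99f2822, 507 lines);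
landed by the second packager p2 gen 4 (p2-g4) in gate run 44 as `HodgeCM/Model/ArchSlotBoxTorusType.lean` (verbatim).
-/
/-
Origin: speedrun cell pub-hodgecm, MODEL-CONSTRUCTION sub-cell, lineage mc-theta-3 (theta supply / second-lift lane, BINDER-OWNERS row 5 `S` slot),
seat planner-pub-hodgecm-mc-theta-3-g13-0 (gen 13), 2026-08-20.  Target in PKG: `HodgeCM/Model/ArchSlotBoxTorusType.lean`
(NEW additive drop-alone leaf; imports this seat's `Model/ArchSlotBoxTorus` (BT) and `Model/ArchSlotTypeLetters` (SL), g12's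
`Model/ArchLineSlotDatum` (LS) and binder-2's installed `HypCensus/SmoothBlockSlotNeg`, `HypCensus/LetterIns`).
KERNEL only: 0 records / `def … : Prop` / cites, 0 proof holes; intended closure {propext, Classical.choice, Quot.sound}.
-/
import Summits.HodgeConjecture.HodgeCM.Model.ArchSlotBoxTorus
import Summits.HodgeConjecture.HodgeCM.Model.ArchSlotTypeLetters_2
import Summits.HodgeConjecture.HodgeCM.Model.ArchLineSlotDatum
import Summits.HodgeConjecture.HodgeCM.Model.HypCensus.SmoothBlockSlotNeg
import Summits.HodgeConjecture.HodgeCM.Model.HypCensus.LetterIns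

/-!
# (J-μ) STEP 2 = residual (R-χ): the antidiagonal type of binder-2's torus character in CLOSED FORM

(BT) `Model/ArchSlotBoxTorus` reduced E's guarded difference `hΔ₁` of #1212 / glue-1 #395 to
`pinTorusType₁ V S hGR h₁W − pinTorusType₀ V S hGR h₁W`, the types of binder-2's ONE torus character `χ_T = pinTorusChar`
on the two factors of `T(L⁺ ⊗ ℝ) = U(1)(L⁺ ⊗ ℝ)²`.  This leaf computes that difference as an explicit `V`-free, `ι₁`-free
integer table `slotDelta S : InfinitePlace L → ℤ` — the shape E's `μ c 1 − μ c 0` must have: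

* §1 generic CM pin `(dV, dW)`, `M = 2`: the torus element `(1, diag u)` IS a value of binder-2's letter section
  (`torusPairHom_eq_letterSection`, by `eq_of_cmPlaceComponent_eq'` + `cmPlaceComponent_torusPairHom`), hence — both being
  pinned by the vacuum — **`χ_T(u) = letterChar (letters of u)`** (`coe_torusChar_eq_letterChar`) and, by (CF)'s generic engine
  `character_eq_prod_vacScalar`, **`χ_T(u) = ∏_v vacScalar (e_v) (torusPlaceLetter v u)`** with binder-2's exponent tuples of record
  `e_v = placeVacExponents v`;
* §2 the vacuum scalar of a torus letter (`vacScalar_torusPlaceLetter`) and of the ONE-PLACE ANTIDIAGONAL element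
  `antiElt w z = ((ι_w ↦ z̄), (ι_w ↦ z))` (`1` at the other places): `1` at a `W`-definite place, `z ^ ±(e_R − e_S)` at a `W`-indefinite one
  (`vacScalar_torusPlaceLetter_antiElt`);
* §3 the plane pin `(frameD V, dW S)` of a `HermSpace3`: the place family `hslot` DISCHARGED from `hpos₀ hpos₁` (at `v₁`: `U(2,1) × U(2,0)`,
  (SD) `exists_slotDatum_of_negCard`; off `v₁`: `V` definite, (SD) `exists_slotDatum_of_definite` /
  `SmoothBlockSlotNeg.exists_isArchWeilDatum_slot_of_definite`), the sign bookkeeping off `v₁` (`V` positive definite,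
  `W` read with true signs, `|P′| − |Q′| = ±3` by the sign of `im w(δ_L)`), and
* §4 **HEADLINE** `pinTorusType₁_sub_pinTorusType₀_apply : pinTorusType₁ w − pinTorusType₀ w = slotDelta S w` with
  `slotDelta S w = 0` if `re w(dW S 0)`, `re w(dW S 1)` have the same sign, else `(±1)·(±3)` (`+1` iff line `1` is the positive one,
  `+3` iff `0 < im w(δ_L)`); and the corollary for E: **`slotTypeVec 1 − slotTypeVec 0 = slotDelta c.D`**
  (`slotTypeVec_one_sub_zero_eq_slotDelta`), i.e. `μ c 1 − μ c 0 := slotDelta c.D` closes `hΔ₁`.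

Nothing here is a claim of PerL/QW8; nothing is cited as a fact.
-/

set_option autoImplicit false

noncomputable section

open scoped Matrix Classical SchwartzMap TensorProduct ComplexConjugate
open MvPolynomial
open NumberField (InfinitePlace maximalRealSubfield IsCMField)
open NumberField.mixedEmbedding (mixedSpace)
open Literature.NumberTheory.Automorphic Literature.NumberTheory.Automorphic.UnitaryGroup Literature.NumberTheory.Weil1964
open Literature.RepresentationTheory.KonnoKonno2007 Literature.RepresentationTheory.KonnoKonno2007.RealDualPair
open Literature.NumberTheory.GelbartRogawski1991 Literature.NumberTheory.GelbartRogawski1991.UnitaryDualPair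
open Literature.RepresentationTheory (atPlace)
open Literature.Analysis.SegalBargmann
open HodgeCM.Adelic HodgeCM.PerL34 HodgeCM.Model.HypCensus

namespace HodgeCM.Model.ArchSideTerm

/-! ## §0 three counting helpers -/

section Count

/-- on `Fin 2`, a predicate holding at exactly one index cuts out a subsingleton. -/
theorem subsingleton_subtype_fin_two {p : Fin 2 → Prop} (h : ¬(p 0 ↔ p 1)) : Subsingleton {j // p j} := by
  have key : ∀ i j : Fin 2, p i → p j → i = j :=
    Fin.forall_fin_two.mpr ⟨Fin.forall_fin_two.mpr ⟨fun _ _ => rfl, fun h0 h1 => (h (iff_of_true h0 h1)).elim⟩,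
      Fin.forall_fin_two.mpr ⟨fun h1 h0 => (h (iff_of_true h0 h1)).elim, fun _ _ => rfl⟩⟩
  exact ⟨fun a b => Subtype.ext (key a.1 b.1 a.2 b.2)⟩

/-- two integer powers that agree on the unit circle are equal. -/
theorem int_eq_of_forall_coe_circle_zpow_eq {a b : ℤ} (h : ∀ z : Circle, (z : ℂ) ^ a = (z : ℂ) ^ b) : a = b := by
  have hone : ∀ z : Circle, z ^ (a - b) = 1 := fun z =>
    Circle.ext (by
      rw [Circle.coe_zpow, Circle.coe_one, zpow_sub₀ (Circle.coe_ne_zero z), h z, div_self (zpow_ne_zero _ (Circle.coe_ne_zero z))])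
  exact sub_eq_zero.mp ((forall_circle_zpow_eq_one_iff _).mp hone)

/-- a product over a subtype of `Fin 2` is a product of two `if`s. -/
theorem prod_subtype_fin_two {A : Type} [CommMonoid A] (p : Fin 2 → Prop) [DecidablePred p] (f : Fin 2 → A) :
    ∏ j : {j // p j}, f j.1 = (if p 0 then f 0 else 1) * (if p 1 then f 1 else 1) := by
  rw [← Finset.prod_subtype (Finset.univ.filter p) (fun j => by simp) f, Finset.prod_filter, Fin.prod_univ_two]

/-- an all-positive vector: `|PosIdx| − |NegIdx| = N`. -/
theorem card_posIdx_sub_card_negIdx_of_pos {N : ℕ} {x : Fin N → ℝ} (h : ∀ i, 0 < x i) :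
    (Fintype.card (PosIdx x) : ℤ) - Fintype.card (NegIdx x) = N := by
  haveI := isEmpty_negIdx h
  rw [Fintype.card_eq_zero (α := NegIdx x), Fintype.card_congr (Equiv.subtypeUnivEquiv (p := fun i => 0 < x i) h),
    Fintype.card_fin, Nat.cast_zero, sub_zero]

/-- an all-negative vector: `|PosIdx| − |NegIdx| = −N`. -/
theorem card_posIdx_sub_card_negIdx_of_neg {N : ℕ} {x : Fin N → ℝ} (h : ∀ i, x i < 0) :
    (Fintype.card (PosIdx x) : ℤ) - Fintype.card (NegIdx x) = -N := by
  haveI := isEmpty_posIdx h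
  rw [Fintype.card_eq_zero (α := PosIdx x),
    Fintype.card_congr (Equiv.subtypeUnivEquiv (p := fun i => ¬0 < x i) fun i => not_lt.mpr (h i).le), Fintype.card_fin,
    Nat.cast_zero, zero_sub]

end Count

/-! ## §1 Generic CM pin, `M = 2`: the torus character IS the letter character on the torus letters -/

section Pin

variable (L : Type) [Field L] [NumberField L] [IsCMField L]
variable (dV : Fin 3 → L) (hdV : ∀ i, IsCMField.complexConj L (dV i) = dV i) (hdV0 : ∀ i, dV i ≠ 0)
variable (dW : Fin 2 → L) (hdW : ∀ i, IsCMField.complexConj L (dW i) = dW i) (hdW0 : ∀ i, dW i ≠ 0)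
variable (hGR : (cmSplittingDatum L finProdFinEquiv dV hdV hdV0 dW hdW hdW0).CompatibleSplitting) (ι₁ : L →+* ℂ)
variable
  (h₁V : ∃ i₀ : Fin 3, (∀ i, i ≠ i₀ → 0 < (ι₁ (dV i)).re) ∨ ∀ i, i ≠ i₀ → (ι₁ (dV i)).re < 0)
  (h₁W : (∀ j, 0 < (ι₁ (dW j)).re) ∨ ∀ j, (ι₁ (dW j)).re < 0)
  (hV : ∀ τ : L →+* ℂ, InfinitePlace.mk τ ≠ InfinitePlace.mk ι₁ → (∀ i, 0 < (τ (dV i)).re) ∨ ∀ i, (τ (dV i)).re < 0)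
  (hW : ∀ τ : L →+* ℂ, InfinitePlace.mk τ ≠ InfinitePlace.mk ι₁ →
    (∃ j₀ : Fin 2, ∀ j, j ≠ j₀ → 0 < (τ (dW j)).re) ∨ ∀ j, (τ (dW j)).re < 0)

/-- **the torus element IS a value of the letter section**: `(1, diag u) = letterSection (v ↦ torusPlaceLetter v u)`. -/
theorem torusPairHom_eq_letterSection (u : NumberField.SeesawArchTorus L) :
    torusPairHom L dV dW u = letterSection L dV hdV hdV0 dW hdW hdW0 ι₁ (fun v => torusPlaceLetter L dV hdV dW hdW ι₁ v u) :=
  eq_of_cmPlaceComponent_eq' L dV hdV hdV0 dW hdW hdW0 ι₁ fun v => by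
    rw [cmPlaceComponent_torusPairHom, cmPlaceComponent_letterSection]

/-- **binder-2's torus character IS its letter character on the torus letters** (both are pinned by the vacuum on the same element). -/
theorem coe_torusChar_eq_letterChar (u : NumberField.SeesawArchTorus L) :
    ((torusChar L dV hdV hdV0 dW hdW hdW0 hGR ι₁ h₁V h₁W hV hW u : Circle) : ℂ) =
      ((letterChar L dV hdV hdV0 dW hdW hdW0 hGR ι₁ h₁V h₁W hV hW (fun v => torusPlaceLetter L dV hdV dW hdW ι₁ v u) : Circle) : ℂ) := by
  have h2 := cmArchWeilRep_letterSection_follandFock_one L dV hdV hdV0 dW hdW hdW0 hGR ι₁ h₁V h₁W hV hW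
    (fun v => torusPlaceLetter L dV hdV dW hdW ι₁ v u)
  rw [← torusPairHom_eq_letterSection, torusPairHom_apply,
    cmArchWeilRep_torus_follandFock_one L dV hdV hdV0 dW hdW hdW0 hGR ι₁ h₁V h₁W hV hW] at h2
  exact smul_left_injective ℂ (follandFock_one_ne_zero _) h2

variable
  (hslot : ∀ v : {v : InfinitePlace ↥(maximalRealSubfield L) // v.IsReal},
    ∃ ω₁ : Representation ℂ
        (Ginf (PosIdx (cmXV L dV hdV ι₁ v)) (NegIdx (cmXV L dV hdV ι₁ v)) (PosIdx (cmXW L dV dW hdW ι₁ v)) (NegIdx (cmXW L dV dW hdW ι₁ v)))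
        (SchwartzMap (DPIdx (PosIdx (cmXV L dV hdV ι₁ v)) (NegIdx (cmXV L dV hdV ι₁ v)) (PosIdx (cmXW L dV dW hdW ι₁ v))
          (NegIdx (cmXW L dV dW hdW ι₁ v)) → ℝ) ℂ),
      IsArchWeilDatum (ι𝕎 _ _ _ _) ω₁ ∧ ∀ u, Continuous (ω₁ u))

/-- **CLOSED FORM OF `χ_T`**: `χ_T(u) = ∏_v vacScalar (e_v) (torusPlaceLetter v u)`, `e_v` binder-2's exponent tuples of record. -/
theorem coe_torusChar_eq_prod_vacScalar (u : NumberField.SeesawArchTorus L) :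
    ((torusChar L dV hdV hdV0 dW hdW hdW0 hGR ι₁ h₁V h₁W hV hW u : Circle) : ℂ) =
      ∏ v, vacScalar (placeVacExponents L finProdFinEquiv dV hdV hdV0 dW hdW hdW0 hGR ι₁ v (Equiv.refl _) (Equiv.refl _) (Equiv.refl _)
        (Equiv.refl _) ⟨h₁V, h₁W, hV, hW⟩ (hslot v)) (torusPlaceLetter L dV hdV dW hdW ι₁ v u) := by
  rw [coe_torusChar_eq_letterChar]
  exact character_eq_prod_vacScalar L finProdFinEquiv dV hdV hdV0 dW hdW hdW0 hGR ι₁ ⟨h₁V, h₁W, hV, hW⟩ hslot _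
    (cmArchWeilRep_letterSection_follandFock_one L dV hdV hdV0 dW hdW hdW0 hGR ι₁ h₁V h₁W hV hW) _

/-- the one-letter case: if the letters of `u` are `mulSingle v k` then `χ_T(u) = vacScalar (e_v) k`. -/
theorem coe_torusChar_eq_vacScalar_of_eq_mulSingle (u : NumberField.SeesawArchTorus L)
    (v : {v : InfinitePlace ↥(maximalRealSubfield L) // v.IsReal})
    (k : DPK (PosIdx (cmXV L dV hdV ι₁ v)) (NegIdx (cmXV L dV hdV ι₁ v)) (PosIdx (cmXW L dV dW hdW ι₁ v)) (NegIdx (cmXW L dV dW hdW ι₁ v)))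
    (hu : (fun v' => torusPlaceLetter L dV hdV dW hdW ι₁ v' u) = Pi.mulSingle v k) :
    ((torusChar L dV hdV hdV0 dW hdW hdW0 hGR ι₁ h₁V h₁W hV hW u : Circle) : ℂ) =
      vacScalar (placeVacExponents L finProdFinEquiv dV hdV hdV0 dW hdW hdW0 hGR ι₁ v (Equiv.refl _) (Equiv.refl _) (Equiv.refl _)
        (Equiv.refl _) ⟨h₁V, h₁W, hV, hW⟩ (hslot v)) k := by
  rw [coe_torusChar_eq_letterChar]
  exact (congrArg (fun h => ((letterChar L dV hdV hdV0 dW hdW hdW0 hGR ι₁ h₁V h₁W hV hW h : Circle) : ℂ)) hu).trans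
    (character_mulSingle_eq_vacScalar L finProdFinEquiv dV hdV hdV0 dW hdW hdW0 hGR ι₁ ⟨h₁V, h₁W, hV, hW⟩ hslot _
      (cmArchWeilRep_letterSection_follandFock_one L dV hdV hdV0 dW hdW hdW0 hGR ι₁ h₁V h₁W hV hW) v k)

/-! ## §2 The vacuum scalar of a torus letter; the one-place antidiagonal element -/

/-- **the vacuum scalar of a torus letter**: the `W`-circles sorted by sign, `(∏_{R} c)^{e_R} · (∏_{S} c)^{e_S}` (the `V`-part is `1`). -/
theorem vacScalar_torusPlaceLetter (ev : VacExponents) (v : {v : InfinitePlace ↥(maximalRealSubfield L) // v.IsReal})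
    (u : NumberField.SeesawArchTorus L) :
    vacScalar ev (torusPlaceLetter L dV hdV dW hdW ι₁ v u) =
      ((if 0 < cmXW L dV dW hdW ι₁ v 0 then ((torusPlaceCircles L v u 0 : Circle) : ℂ) else 1) *
            (if 0 < cmXW L dV dW hdW ι₁ v 1 then ((torusPlaceCircles L v u 1 : Circle) : ℂ) else 1)) ^ ev.eR *
        ((if 0 < cmXW L dV dW hdW ι₁ v 0 then 1 else ((torusPlaceCircles L v u 0 : Circle) : ℂ)) *
            (if 0 < cmXW L dV dW hdW ι₁ v 1 then 1 else ((torusPlaceCircles L v u 1 : Circle) : ℂ))) ^ ev.eS := by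
  rw [vacScalar, torusPlaceLetter_fst, torusPlaceLetter_snd]
  simp only [Prod.fst_one, Prod.snd_one, OneMemClass.coe_one, Matrix.det_one, one_zpow, one_mul, coe_diagHom, Matrix.det_diagonal,
    circleRestrict_apply]
  rw [prod_subtype_fin_two (fun j => 0 < cmXW L dV dW hdW ι₁ v j) (fun j => ((torusPlaceCircles L v u j : Circle) : ℂ)),
    prod_subtype_fin_two (fun j => ¬0 < cmXW L dV dW hdW ι₁ v j) (fun j => ((torusPlaceCircles L v u j : Circle) : ℂ))]
  simp only [ite_not]

/-- PerL34's place character on the tree's one-place subtorus: `z` at `w`, `1` elsewhere (the two `archPlaceChar`s agree on values). -/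
theorem archPlaceChar_archCoord (w w' : InfinitePlace L) (z : Circle) :
    NumberField.archPlaceChar L w' (archCoord L w z) = Pi.mulSingle (M := fun _ : InfinitePlace L => Circle) w z w' := by
  have h := congr_fun (archPlaceChars_archCoord L w z) w'
  rw [archPlaceChars_apply] at h
  exact Circle.ext (by rw [← h]; rfl)

/-- **the one-place antidiagonal torus element** `((ι_w ↦ z̄, 1 elsewhere), (ι_w ↦ z, 1 elsewhere)) ∈ T(L⁺ ⊗ ℝ)`. -/
def antiElt (w : InfinitePlace L) (z : Circle) : NumberField.SeesawArchTorus L :=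
  NumberField.SeesawArchTorus.mk L (archCoord L w z⁻¹) (archCoord L w z)

/-- (Ported verbatim from the HodgeCMPerL package; no docstring in the source.) -/
theorem torusPlaceCircles_antiElt_zero (v : {v : InfinitePlace ↥(maximalRealSubfield L) // v.IsReal}) (w : InfinitePlace L) (z : Circle) :
    torusPlaceCircles L v (antiElt L w z) 0 = Pi.mulSingle (M := fun _ : InfinitePlace L => Circle) w z⁻¹ (cmPlaceOver L v).1 := by
  rw [torusPlaceCircles_apply_zero, antiElt, NumberField.SeesawArchTorus.fst_mk, archPlaceChar_archCoord]

/-- (Ported verbatim from the HodgeCMPerL package; no docstring in the source.) -/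
theorem torusPlaceCircles_antiElt_one (v : {v : InfinitePlace ↥(maximalRealSubfield L) // v.IsReal}) (w : InfinitePlace L) (z : Circle) :
    torusPlaceCircles L v (antiElt L w z) 1 = Pi.mulSingle (M := fun _ : InfinitePlace L => Circle) w z (cmPlaceOver L v).1 := by
  rw [torusPlaceCircles_apply_one, antiElt, NumberField.SeesawArchTorus.snd_mk, archPlaceChar_archCoord]

/-- a torus element with trivial circles at `v` has the trivial letter at `v`. -/
theorem torusPlaceLetter_eq_one (v : {v : InfinitePlace ↥(maximalRealSubfield L) // v.IsReal}) (u : NumberField.SeesawArchTorus L)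
    (h0 : torusPlaceCircles L v u 0 = 1) (h1 : torusPlaceCircles L v u 1 = 1) : torusPlaceLetter L dV hdV dW hdW ι₁ v u = 1 := by
  have hu : torusPlaceCircles L v u = 1 := funext fun j => by fin_cases j <;> assumption
  refine Prod.ext (torusPlaceLetter_fst L dV hdV dW hdW ι₁ v u) ?_
  rw [torusPlaceLetter_snd, hu, map_one, map_one, map_one, map_one, Prod.snd_one, Prod.mk_one_one]

/-- **the letters of the antidiagonal element at `w(v₀)` are ONE letter at `v₀`.** -/
theorem torusPlaceLetter_antiElt_eq_mulSingle (v₀ : {v : InfinitePlace ↥(maximalRealSubfield L) // v.IsReal}) (z : Circle) :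
    (fun v => torusPlaceLetter L dV hdV dW hdW ι₁ v (antiElt L (cmPlaceOver L v₀).1 z)) =
      Pi.mulSingle v₀ (torusPlaceLetter L dV hdV dW hdW ι₁ v₀ (antiElt L (cmPlaceOver L v₀).1 z)) := by
  funext v
  by_cases hv : v = v₀
  · subst hv; rw [Pi.mulSingle_eq_same]
  · rw [Pi.mulSingle_eq_of_ne hv]
    have hne : (cmPlaceOver L v).1 ≠ (cmPlaceOver L v₀).1 := fun h => hv (cmPlaceOver_injective L (Subtype.ext h))
    refine torusPlaceLetter_eq_one L dV hdV dW hdW ι₁ v _ ?_ ?_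
    · rw [torusPlaceCircles_antiElt_zero, Pi.mulSingle_eq_of_ne hne]
    · rw [torusPlaceCircles_antiElt_one, Pi.mulSingle_eq_of_ne hne]

/-- **the vacuum scalar of the antidiagonal letter at its own place**: `1` where `W` reads definite, `z^{±(e_R − e_S)}` where it reads
indefinite (`+` iff coordinate `1` is the positive one). -/
theorem vacScalar_torusPlaceLetter_antiElt (ev : VacExponents) (v : {v : InfinitePlace ↥(maximalRealSubfield L) // v.IsReal}) (z : Circle) :
    vacScalar ev (torusPlaceLetter L dV hdV dW hdW ι₁ v (antiElt L (cmPlaceOver L v).1 z)) =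
      (z : ℂ) ^ (if (0 < cmXW L dV dW hdW ι₁ v 0 ↔ 0 < cmXW L dV dW hdW ι₁ v 1) then (0 : ℤ)
        else if 0 < cmXW L dV dW hdW ι₁ v 1 then ev.eR - ev.eS else ev.eS - ev.eR) := by
  rw [vacScalar_torusPlaceLetter, torusPlaceCircles_antiElt_zero, torusPlaceCircles_antiElt_one, Pi.mulSingle_eq_same, Pi.mulSingle_eq_same,
    Circle.coe_inv]
  have hz : (z : ℂ) ≠ 0 := Circle.coe_ne_zero z
  by_cases h0 : 0 < cmXW L dV dW hdW ι₁ v 0 <;> by_cases h1 : 0 < cmXW L dV dW hdW ι₁ v 1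
  · rw [if_pos h0, if_pos h0, if_pos h1, if_pos h1, if_pos (iff_of_true h0 h1), inv_mul_cancel₀ hz, one_zpow, one_mul, mul_one,
      one_zpow, zpow_zero]
  · rw [if_pos h0, if_pos h0, if_neg h1, if_neg h1, if_neg (fun h => h1 (h.mp h0)), if_neg h1, mul_one, one_mul, inv_zpow',
      ← zpow_add₀ hz, neg_add_eq_sub]
  · rw [if_neg h0, if_neg h0, if_pos h1, if_pos h1, if_neg (fun h => h0 (h.mpr h1)), if_pos h1, one_mul, mul_one, inv_zpow',
      ← zpow_add₀ hz, ← sub_eq_add_neg]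
  · rw [if_neg h0, if_neg h0, if_neg h1, if_neg h1, if_pos (iff_of_false h0 h1), one_mul, one_zpow, one_mul, inv_mul_cancel₀ hz,
      one_zpow, zpow_zero]

end Pin

/-! ## §3 The plane pin of a `HermSpace3`: place family discharged, signs off `v₁` -/

section Plane

variable {L : CMField} {ι₁ : L →+* ℂ} (V : HermSpace3 L ι₁) (S : StubTree.SeesawDatum L)
variable (hGR : (cmSplittingDatum (L : Type) finProdFinEquiv (frameD V) (frameD_real V) (frameD_ne V) (dW S) (dW_real S) (dW_ne S)).CompatibleSplitting)
variable (h₁W : (∀ j, 0 < (ι₁ (dW S j)).re) ∨ ∀ j, (ι₁ (dW S j)).re < 0)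
variable
  (hpos₀ : 0 < cmXW (L : Type) (frameD V) (lineVec (L : Type) (dW S 0)) (fun _ => dW_real S 0) ι₁ (HypCensus.cmPlace (L : Type) ι₁) 0)
  (hpos₁ : 0 < cmXW (L : Type) (frameD V) (lineVec (L : Type) (dW S 1)) (fun _ => dW_real S 1) ι₁ (HypCensus.cmPlace (L : Type) ι₁) 0)

include hpos₀ hpos₁ in
/-- **the place family `hslot` of the PLANE pin, discharged**: at `v₁` the slot reads `U(2,1) × U(2,0)` (both lines positive, (SD)
`exists_slotDatum_of_negCard`); off `v₁` the `V`-side reads definite and the slot is (SD) `exists_slotDatum_of_definite` or, at a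
`W`-indefinite place, binder-2's `exists_isArchWeilDatum_slot_of_definite`. -/
theorem planeSlotFamily (v : {v : InfinitePlace ↥(maximalRealSubfield (L : Type)) // v.IsReal}) :
    ∃ ω₁ : Representation ℂ
        (Ginf (PosIdx (cmXV (L : Type) (frameD V) (frameD_real V) ι₁ v)) (NegIdx (cmXV (L : Type) (frameD V) (frameD_real V) ι₁ v))
          (PosIdx (cmXW (L : Type) (frameD V) (dW S) (dW_real S) ι₁ v)) (NegIdx (cmXW (L : Type) (frameD V) (dW S) (dW_real S) ι₁ v)))
        (SchwartzMap (DPIdx (PosIdx (cmXV (L : Type) (frameD V) (frameD_real V) ι₁ v)) (NegIdx (cmXV (L : Type) (frameD V) (frameD_real V) ι₁ v))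
          (PosIdx (cmXW (L : Type) (frameD V) (dW S) (dW_real S) ι₁ v)) (NegIdx (cmXW (L : Type) (frameD V) (dW S) (dW_real S) ι₁ v)) → ℝ) ℂ),
      IsArchWeilDatum (ι𝕎 _ _ _ _) ω₁ ∧ ∀ u, Continuous (ω₁ u) := by
  by_cases hv : v = HypCensus.cmPlace (L : Type) ι₁
  · subst hv
    have hpos₀' : 0 < cmXW (L : Type) (frameD V) (dW S) (dW_real S) ι₁ (HypCensus.cmPlace (L : Type) ι₁) 0 := hpos₀
    have hpos₁' : 0 < cmXW (L : Type) (frameD V) (dW S) (dW_real S) ι₁ (HypCensus.cmPlace (L : Type) ι₁) 1 := hpos₁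
    haveI : IsEmpty (NegIdx (cmXW (L : Type) (frameD V) (dW S) (dW_real S) ι₁ (HypCensus.cmPlace (L : Type) ι₁))) :=
      isEmpty_negIdx (Fin.forall_fin_two.mpr ⟨hpos₀', hpos₁'⟩)
    haveI : Nonempty (PosIdx (cmXW (L : Type) (frameD V) (dW S) (dW_real S) ι₁ (HypCensus.cmPlace (L : Type) ι₁))) := ⟨⟨0, hpos₀'⟩⟩
    haveI : Subsingleton (NegIdx (cmXV (L : Type) (frameD V) (frameD_real V) ι₁ (HypCensus.cmPlace (L : Type) ι₁))) :=
      (cmNegIdxEquivUnit (L : Type) (frameD V) (frameD_real V) ι₁ (frameD_sign_ι₁ V)).subsingleton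
    exact exists_slotDatum_of_negCard
      ((cmPosIdxEquivFin (L : Type) (frameD V) (frameD_real V) ι₁ (frameD_sign_ι₁ V)).symm 0)
      ((cmNegIdxEquivUnit (L : Type) (frameD V) (frameD_real V) ι₁ (frameD_sign_ι₁ V)).symm ())
  · have hVd := isEmpty_posIdx_or_negIdx_cmXV_frameD_of_ne V v hv
    by_cases hW : (0 < cmXW (L : Type) (frameD V) (dW S) (dW_real S) ι₁ v 0 ↔ 0 < cmXW (L : Type) (frameD V) (dW S) (dW_real S) ι₁ v 1)
    · have hWd : IsEmpty (PosIdx (cmXW (L : Type) (frameD V) (dW S) (dW_real S) ι₁ v)) ∨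
          IsEmpty (NegIdx (cmXW (L : Type) (frameD V) (dW S) (dW_real S) ι₁ v)) := by
        by_cases h0 : 0 < cmXW (L : Type) (frameD V) (dW S) (dW_real S) ι₁ v 0
        · exact Or.inr (isEmpty_negIdx (Fin.forall_fin_two.mpr ⟨h0, hW.mp h0⟩))
        · have hn : ∀ j, ¬0 < cmXW (L : Type) (frameD V) (dW S) (dW_real S) ι₁ v j :=
            Fin.forall_fin_two.mpr ⟨h0, fun h1 => h0 (hW.mpr h1)⟩
          exact Or.inl ⟨fun j => hn j.1 j.2⟩
      exact exists_slotDatum_of_definite hVd hWd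
    · haveI : Subsingleton (PosIdx (cmXW (L : Type) (frameD V) (dW S) (dW_real S) ι₁ v)) := subsingleton_subtype_fin_two hW
      haveI : Subsingleton (NegIdx (cmXW (L : Type) (frameD V) (dW S) (dW_real S) ι₁ v)) :=
        subsingleton_subtype_fin_two (p := fun j => ¬0 < cmXW (L : Type) (frameD V) (dW S) (dW_real S) ι₁ v j) fun h => hW (not_iff_not.mp h)
      have hV' : (IsEmpty (NegIdx (cmXV (L : Type) (frameD V) (frameD_real V) ι₁ v)) ∧
            Nonempty (PosIdx (cmXV (L : Type) (frameD V) (frameD_real V) ι₁ v))) ∨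
          (IsEmpty (PosIdx (cmXV (L : Type) (frameD V) (frameD_real V) ι₁ v)) ∧
            Nonempty (NegIdx (cmXV (L : Type) (frameD V) (frameD_real V) ι₁ v))) := by
        rcases hVd with hP | hQ
        · exact Or.inr ⟨hP, ⟨⟨0, fun h => hP.false ⟨0, h⟩⟩⟩⟩
        · exact Or.inl ⟨hQ, ⟨⟨0, not_not.mp fun h => hQ.false ⟨0, h⟩⟩⟩⟩
      by_cases h0 : 0 < cmXW (L : Type) (frameD V) (dW S) (dW_real S) ι₁ v 0
      · exact exists_isArchWeilDatum_slot_of_definite hV' ⟨0, h0⟩ ⟨1, fun h1 => hW (iff_of_true h0 h1)⟩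
      · have h1 : 0 < cmXW (L : Type) (frameD V) (dW S) (dW_real S) ι₁ v 1 := by
          by_contra h1; exact hW (iff_of_false h0 h1)
        exact exists_isArchWeilDatum_slot_of_definite hV' ⟨1, h1⟩ ⟨0, h0⟩

/-- **the exponent tuples of record of the plane pin** (binder-2's `placeVacExponents`, identity block frames, the place family above). -/
def planeVacExponents (v : {v : InfinitePlace ↥(maximalRealSubfield (L : Type)) // v.IsReal}) : VacExponents :=
  placeVacExponents (L : Type) finProdFinEquiv (frameD V) (frameD_real V) (frameD_ne V) (dW S) (dW_real S) (dW_ne S) hGR ι₁ v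
    (Equiv.refl _) (Equiv.refl _) (Equiv.refl _) (Equiv.refl _)
    ⟨frameD_sign_ι₁' V, h₁W, frameD_sign_of_ne V, fun τ' _ =>
      signs_fin_two fun j => re_apply_ne_zero_of_complexConj_eq (L : Type) τ' (dW_real S j) (dW_ne S j)⟩
    (planeSlotFamily V S hpos₀ hpos₁ v)

/-- binder-2's pinned `W`-side difference for the plane pin: `e_R − e_S = |P′| − |Q′|` at a `W`-indefinite place. -/
theorem planeVacExponents_eR_sub_eS (v : {v : InfinitePlace ↥(maximalRealSubfield (L : Type)) // v.IsReal})
    (r₀ : PosIdx (cmXW (L : Type) (frameD V) (dW S) (dW_real S) ι₁ v)) (s₀ : NegIdx (cmXW (L : Type) (frameD V) (dW S) (dW_real S) ι₁ v)) :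
    (planeVacExponents V S hGR h₁W hpos₀ hpos₁ v).eR - (planeVacExponents V S hGR h₁W hpos₀ hpos₁ v).eS =
      (Fintype.card (PosIdx (cmXV (L : Type) (frameD V) (frameD_real V) ι₁ v)) : ℤ) -
        Fintype.card (NegIdx (cmXV (L : Type) (frameD V) (frameD_real V) ι₁ v)) :=
  placeVacExponents_eR_sub_eS (L : Type) finProdFinEquiv (frameD V) (frameD_real V) (frameD_ne V) (dW S) (dW_real S) (dW_ne S) hGR ι₁ v
    (Equiv.refl _) (Equiv.refl _) (Equiv.refl _) (Equiv.refl _) _ _ r₀ s₀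

/-- **`χ_T` on the antidiagonal element at `w(v)`** is `z ^ (0 | ±(e_R − e_S))` with the plane pin's exponents of record at `v`. -/
theorem coe_pinTorusChar_antiElt (v : {v : InfinitePlace ↥(maximalRealSubfield (L : Type)) // v.IsReal}) (z : Circle) :
    ((pinTorusChar V S hGR h₁W (antiElt (L : Type) (cmPlaceOver (L : Type) v).1 z) : Circle) : ℂ) =
      (z : ℂ) ^ (if (0 < cmXW (L : Type) (frameD V) (dW S) (dW_real S) ι₁ v 0 ↔ 0 < cmXW (L : Type) (frameD V) (dW S) (dW_real S) ι₁ v 1)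
        then (0 : ℤ)
        else if 0 < cmXW (L : Type) (frameD V) (dW S) (dW_real S) ι₁ v 1 then
          (planeVacExponents V S hGR h₁W hpos₀ hpos₁ v).eR - (planeVacExponents V S hGR h₁W hpos₀ hpos₁ v).eS
        else (planeVacExponents V S hGR h₁W hpos₀ hpos₁ v).eS - (planeVacExponents V S hGR h₁W hpos₀ hpos₁ v).eR) :=
  (coe_torusChar_eq_vacScalar_of_eq_mulSingle (L : Type) (frameD V) (frameD_real V) (frameD_ne V) (dW S) (dW_real S) (dW_ne S) hGR ι₁
      (frameD_sign_ι₁' V) h₁W (frameD_sign_of_ne V)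
      (fun τ' _ => signs_fin_two fun j => re_apply_ne_zero_of_complexConj_eq (L : Type) τ' (dW_real S j) (dW_ne S j))
      (planeSlotFamily V S hpos₀ hpos₁) _ v _
      (torusPlaceLetter_antiElt_eq_mulSingle (L : Type) (frameD V) (frameD_real V) (dW S) (dW_real S) ι₁ v z)).trans
    (vacScalar_torusPlaceLetter_antiElt (L : Type) (frameD V) (frameD_real V) (dW S) (dW_real S) ι₁ _ v z)

include hpos₀ hpos₁ in
/-- **the antidiagonal type of `χ_T` at `w(v)`, through the exponents of record.** -/
theorem pinTorusType₁_sub_pinTorusType₀_cmPlaceOver (v : {v : InfinitePlace ↥(maximalRealSubfield (L : Type)) // v.IsReal}) :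
    pinTorusType₁ V S hGR h₁W (cmPlaceOver (L : Type) v).1 - pinTorusType₀ V S hGR h₁W (cmPlaceOver (L : Type) v).1 =
      (if (0 < cmXW (L : Type) (frameD V) (dW S) (dW_real S) ι₁ v 0 ↔ 0 < cmXW (L : Type) (frameD V) (dW S) (dW_real S) ι₁ v 1)
        then (0 : ℤ)
        else if 0 < cmXW (L : Type) (frameD V) (dW S) (dW_real S) ι₁ v 1 then
          (planeVacExponents V S hGR h₁W hpos₀ hpos₁ v).eR - (planeVacExponents V S hGR h₁W hpos₀ hpos₁ v).eS
        else (planeVacExponents V S hGR h₁W hpos₀ hpos₁ v).eS - (planeVacExponents V S hGR h₁W hpos₀ hpos₁ v).eR) := by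
  refine int_eq_of_forall_coe_circle_zpow_eq fun z => ?_
  have hz : (z : ℂ) ≠ 0 := Circle.coe_ne_zero z
  have h := coe_pinTorusChar_antiElt V S hGR h₁W hpos₀ hpos₁ v z
  rw [antiElt, pinTorusChar_mk,
    charArchType_archCoord (L : Type) (pinTorusChar₀ V S hGR h₁W) (continuous_pinTorusChar₀ V S hGR h₁W) _ z⁻¹,
    charArchType_archCoord (L : Type) (pinTorusChar₁ V S hGR h₁W) (continuous_pinTorusChar₁ V S hGR h₁W) _ z,
    Circle.coe_zpow, Circle.coe_zpow, Circle.coe_inv, inv_zpow', ← zpow_add₀ hz, neg_add_eq_sub] at h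
  exact h

/-! ### signs off `v₁` -/

/-- the embedding of `w(v)`, `v ≠ v₁`, is off the place of `ι₁`. -/
theorem mk_embedding_cmPlaceOver_ne {v : {v : InfinitePlace ↥(maximalRealSubfield (L : Type)) // v.IsReal}}
    (hv : v ≠ HypCensus.cmPlace (L : Type) ι₁) :
    NumberField.InfinitePlace.mk (cmPlaceOver (L : Type) v).1.embedding ≠ NumberField.InfinitePlace.mk ι₁ := by
  rw [NumberField.InfinitePlace.mk_embedding]
  intro h
  exact hv (Subtype.ext (by rw [← cmPlaceOver_comap (L : Type) v, h]; rfl))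

/-- **off `v₁` the canonical `V`-vector of the frame of `V` is `re w(v)(d_i) / im w(v)(δ_L)`** (no `ι₁`-convention). -/
theorem cmXV_frameD_apply_of_ne {v : {v : InfinitePlace ↥(maximalRealSubfield (L : Type)) // v.IsReal}}
    (hv : v ≠ HypCensus.cmPlace (L : Type) ι₁) (i : Fin 3) :
    cmXV (L : Type) (frameD V) (frameD_real V) ι₁ v i =
      ((cmPlaceOver (L : Type) v).1.embedding (frameD V i)).re / ((cmPlaceOver (L : Type) v).1.embedding (imagUnit (L : Type))).im := by
  show placeSignVec (cmRealVec (L : Type) (frameD V) (frameD_real V)) (cmSignConv (L : Type) (frameD V) ι₁) v i = _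
  rw [placeSignVec_cmRealVec (L : Type) v (cmPlaceOver (L : Type) v).1.embedding (comap_mk_embedding_cmPlaceOver (L : Type) v)
    (frameD V) (frameD_real V), cmSignConv, if_neg (val_ne_comap_of_ne_cmPlace hv)]

/-- **off `v₁` the `V`-side difference `|P′| − |Q′|` is `±3` by the sign of `im w(v)(δ_L)`** (`V` is positive definite there). -/
theorem card_posIdx_sub_card_negIdx_cmXV_of_ne {v : {v : InfinitePlace ↥(maximalRealSubfield (L : Type)) // v.IsReal}}
    (hv : v ≠ HypCensus.cmPlace (L : Type) ι₁) :
    (Fintype.card (PosIdx (cmXV (L : Type) (frameD V) (frameD_real V) ι₁ v)) : ℤ) -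
        Fintype.card (NegIdx (cmXV (L : Type) (frameD V) (frameD_real V) ι₁ v)) =
      if 0 < ((cmPlaceOver (L : Type) v).1.embedding (imagUnit (L : Type))).im then 3 else -3 := by
  have hs := im_embedding_cmPlaceOver_imagUnit_ne_zero (L : Type) v
  have hp : ∀ i, 0 < ((cmPlaceOver (L : Type) v).1.embedding (frameD V i)).re := frameD_pos_of_ne V _ (mk_embedding_cmPlaceOver_ne hv)
  split_ifs with h
  · exact (card_posIdx_sub_card_negIdx_of_pos fun i => by rw [cmXV_frameD_apply_of_ne V hv]; exact div_pos (hp i) h).trans (by norm_num)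
  · exact (card_posIdx_sub_card_negIdx_of_neg fun i => by
      rw [cmXV_frameD_apply_of_ne V hv]; exact div_neg_of_pos_of_neg (hp i) (lt_of_le_of_ne (not_lt.mp h) hs)).trans (by norm_num)


-- port_pkg: scope closed for this part
end Plane
end HodgeCM.Model.ArchSideTerm
end
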